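import Literature.NumberTheory.Transcendental.DiazMainIIISmallEventually
import Literature.NumberTheory.Transcendental.DiazMainIIIZeroFreeBall
import Literature.NumberTheory.Transcendental.DiazMainIIIProofs
import Literature.NumberTheory.Transcendental.DiazThm1Proofs
import HarnessLib

/-!
# Laurent's Théorème 3 iii) from Philippon's criterion and zero estimate — the assembly

Topic `Literature/NumberTheory/Transcendental`. Last step of the CONDITIONAL proof of
`Diaz1989_main_iii` (`DiazMain.lean`: M. Laurent, *Sur quelques résultats récents de transcendance*,
Astérisque 198–200 (1991), §3.1, Théorème 3 iii), p. 213 — Diaz 1989 / Philippon 1986, Thm 2.12 (i):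
for `x ∈ ℂ^m`, `y ∈ ℂ^n` `ℚ`-free with measures of linear independence of exponents `1` and
`(mn+m+n-1)/(2m+n)`, `trdeg_ℚ ℚ(x, y, e^{xy}) ≥ ⌈mn/(m+n)⌉`) from the two named tools of the tree,
`Philippon1986_mainCriterion` (Philippon's criterion for algebraic independence, Thm 2.11) and
`Philippon1986_GaGm` (Philippon's zero estimate on `𝔾ₐ × 𝔾ₘⁿ`):

`Diaz1989_main_iii_of_criterion : Philippon1986_mainCriterion → Philippon1986_GaGm → Diaz1989_main_iii`.

The ranges `mn ≤ 2(m+n)` are unconditional (`DiazMainIIIProofs.lean`,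
`Diaz1989_main_iii_of_largeRange'`). In the large range `mn > 2(m+n)` (so `m, n ≥ 3` and
`K = ⌈mn/(m+n)⌉ ≥ 3`) the proof is Gel'fond's method WITH derivatives on `𝔾ₐ × 𝔾ₘⁿ` in Diaz's
architecture (the previous files `DiazZeroLemmaMult`, `HermiteInterpolationBound`,
`DiazMainIIIConstruction`, `DiazMainIIISmallness`, `DiazMainIIIParams`, `DiazMainIIISmallBound`,
`DiazMainIIISmallEventually`, `DiazMainIIIZeroFreeBall`): with the `m` POINTS `x` (linear measure:
separation of the points `l·x` and relations of height `LB²Δ`) and the `n` FREQUENCIES `y`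
(measure used only at height `L`), the family `Q_{l,t,j}` (`l ≤ M₂`, `t < S`, `j` a minimal index at
a point of the ball `𝓑_ρ`) fed to the criterion at `θ = (y, x, e^{yx}) ∈ ℂ^{n+m+nm}` satisfies:
degrees and logarithmic lengths `≤ X^{a₁}`, `a₁ = 1 + m/n + ε₁` (`degLen_at`); smallness
`|Q(θ)| ≤ e^{-S}`, `S = Ψ/2^{m+4}`, `Ψ = X^{1+m/n+m} log X` (`eventually_small3`); no common zero
in the ball of radius `e^{-R}`, `R = ρ = 4Ψ` (`eventually_zeroFree3`); and with `k + 1 = K`,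
`ε₀ = (1 + m/n + m) - K(1 + m/n) > 0` (i.e. `k < mn/(m+n)`), `ε₁ = ε₀/(2K)`, the growth conditions
of the criterion hold: `S/((σ+δ)δ^k) = 2^{-(m+5)} X^{ε₀/2} log X` is non-decreasing and
`S^{k+2} ≥ C(σ+δ)δ^k(S^{k+1} + R^{k+1})` eventually (`main_ineq_at3`). Hence
`trdeg ℚ(θ) ≥ k + 1 = ⌈mn/(m+n)⌉`.

* `coeffs3`, `famPoly3`, `GoodX3`, `eventually_goodX3` — Siegel's coefficients, the family and the
  bundle of eventual facts at level `X` (as in `DiazThm1Proofs.lean`); `Tdeg_le`, `degLen_at` — the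
  degree and length bounds; `varEquiv3` — `Var n m ≃ Fin (n + m + nm)`; `sigF3`, `RF3`, `SF3`,
  `ratio_eq3`, `ratio_mono3`, `Kmain3`, `main_ineq_at3` — the functions of the criterion and its two
  growth conditions; `k_mul_lt` — `k(m+n) < mn`.
* `Diaz1989_main_iii_of_criterion` — the assembly. What remains for `Diaz1989_main_iii_holds` is
  exactly the two named tools (both open in the tree).

Everything here is PROVED (no named fact is introduced); the parameter choices and the
bookkeeping of the multiplicity proof are ours — the printed sources (Laurent's survey; Diaz 1989
without multiplicities; Philippon 1986) give the statement and the model.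

## References

* M. Laurent, *Sur quelques résultats récents de transcendance*, Astérisque 198–200 (1991),
  209–230, §3.1, Théorème 3 iii), p. 213. [Laurent1991]
* G. Diaz, *Grands degrés de transcendance pour des familles d'exponentielles*, J. Number Theory
  31 (1989), 1–23 (Théorème 1; Critère p. 16; §II-4). [Diaz1989]
* P. Philippon, *Critères pour l'indépendance algébrique*, Publ. Math. IHÉS 64 (1986), 5–52,
  Thm 2.11, Thm 2.12. [Philippon1986Criteres]
* P. Philippon, *Lemmes de zéros dans les groupes algébriques commutatifs*, Bull. Soc. Math.
  France 114 (1986), 355–383. [Philippon1986]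
-/

noncomputable section

open MvPolynomial Finset Finsupp Complex Filter Real
open Literature.NumberTheory.Transcendental.ExpGrid
open Literature.NumberTheory.Transcendental.Asymp
open Literature.NumberTheory.Transcendental.Chudnovsky (wnorm wnorm_nonneg l1)
open Literature.NumberTheory.Transcendental.Taylor
open Literature.NumberTheory.Transcendental.DiazThm1 (scale_zero_eq_exp scale_mono scale_add_one_le
  scale_div_scale l1_rename_of_injective trdeg_adjoin_congr one_le_scale three_le_X exp_one_le_X)

namespace Literature.NumberTheory.Transcendental

namespace DiazMainIII

variable {n m' : ℕ}

/-! ### Siegel's coefficients and the family of polynomials at `X` -/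

section Family

variable (y : Fin n → ℂ) (x : Fin (m' + 1) → ℂ)

open Classical in
/-- The unknowns `p` of Siegel's step at `X` (`exists_coeffs`: not all zero, `|p| ≤ H`,
`Q_{l,t} = 0` for `l ∈ [0,M)^m`, `t < S`), when they exist; `0` otherwise. [folklore] -/
def coeffs3 (n m' : ℕ) (X : ℝ) :
    Unk n (m' + 1) (Dq n (m' + 1) X) (Lq n (m' + 1) X) (bq n (m' + 1) X) → ℤ :=
  if h : ∃ p : Unk n (m' + 1) (Dq n (m' + 1) X) (Lq n (m' + 1) X) (bq n (m' + 1) X) → ℤ, p ≠ 0 ∧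
      (∀ w, |(p w : ℝ)| ≤ Hgt3 n (m' + 1) X) ∧
      ∀ l : Fin (m' + 1) → ℕ, (∀ k, l k < Mq X) → ∀ t < Sq n (m' + 1) X, Q p l t = 0
  then h.choose else 0

/-- Under (𝒞1) the unknowns exist, so `coeffs3` has the three properties of Siegel's step.
[folklore] -/
theorem coeffs3_spec {X : ℝ} (hD : 1 ≤ Dq n (m' + 1) X) (hM : 1 ≤ Mq X) (hS : 1 ≤ Sq n (m' + 1) X)
    (hC1 : 2 * (Mq X ^ (m' + 1) * (Sq n (m' + 1) X * (bq n (m' + 1) X +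
      (Sq n (m' + 1) X + Dq n (m' + 1) X + n * (m' + 1) * Lq n (m' + 1) X * Mq X)) ^
        Fintype.card (Var n (m' + 1)))) ≤
      Dq n (m' + 1) X * Lq n (m' + 1) X ^ n * bq n (m' + 1) X ^ Fintype.card (Var n (m' + 1))) :
    coeffs3 n m' X ≠ 0 ∧ (∀ w, |(coeffs3 n m' X w : ℝ)| ≤ Hgt3 n (m' + 1) X) ∧
      ∀ l : Fin (m' + 1) → ℕ, (∀ k, l k < Mq X) → ∀ t < Sq n (m' + 1) X, Q (coeffs3 n m' X) l t = 0 := by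
  classical
  have h : ∃ p : Unk n (m' + 1) (Dq n (m' + 1) X) (Lq n (m' + 1) X) (bq n (m' + 1) X) → ℤ, p ≠ 0 ∧
      (∀ w, |(p w : ℝ)| ≤ Hgt3 n (m' + 1) X) ∧
      ∀ l : Fin (m' + 1) → ℕ, (∀ k, l k < Mq X) → ∀ t < Sq n (m' + 1) X, Q p l t = 0 := by
    obtain ⟨p, hp0, hpb, hpv⟩ := exists_coeffs (n := n) (m := m' + 1) (D := Dq n (m' + 1) X)
      (L := Lq n (m' + 1) X) (b := bq n (m' + 1) X) (M := Mq X) (S := Sq n (m' + 1) X) hD hM hS hC1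
    refine ⟨p, hp0, fun w => (hpb w).trans (le_of_eq ?_), hpv⟩
    rw [Hgt3]
  rw [coeffs3, dif_pos h]
  exact h.choose_spec

/-- The ball `𝓑_ρ`: `max |θ'_v - θ_v| ≤ e^{-ρ}`. [folklore] -/
def InBall3 (X : ℝ) (θ' : Var n (m' + 1) → ℂ) : Prop :=
  ∀ v, ‖θ' v - pt y x v‖ ≤ Real.exp (-rho3 n (m' + 1) X)

/-- `θ ∈ 𝓑_ρ`. [folklore] -/
theorem inBall3_pt (X : ℝ) : InBall3 y x X (pt y x) := fun v => by
  simp [le_of_lt (Real.exp_pos _)]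

/-- The good indices at `X`: minimal indices (for `coeffs3`) at points of the ball. [folklore] -/
def GoodIdx3 (X : ℝ) (j : Var n (m' + 1) →₀ ℕ) : Prop :=
  ∃ θ' : Var n (m' + 1) → ℂ, InBall3 y x X θ' ∧ IsMinIdx (coeffs3 n m' X) θ' j

open Classical in
/-- A minimal index at `θ` itself (when `coeffs3 ≠ 0`), else `0`. [folklore] -/
def j03 (X : ℝ) : Var n (m' + 1) →₀ ℕ :=
  if h : ∃ j, IsMinIdx (coeffs3 n m' X) (pt y x) j then h.choose else 0

/-- `j03` is a minimal index at `θ` as soon as `coeffs3 ≠ 0`. [folklore] -/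
theorem isMinIdx_j03 {X : ℝ} (h : coeffs3 n m' X ≠ 0) :
    IsMinIdx (coeffs3 n m' X) (pt y x) (j03 y x X) := by
  classical
  have hex : ∃ j, IsMinIdx (coeffs3 n m' X) (pt y x) j := exists_isMinIdx h _
  rw [j03, dif_pos hex]
  exact hex.choose_spec

/-- The bound `T_X = (b-1)#Var` for the entries of a minimal index. [folklore] -/
abbrev TX3 (n m' : ℕ) (X : ℝ) : ℕ := (bq n (m' + 1) X - 1) * Fintype.card (Var n (m' + 1))

/-- The index type of the family at `X`: `l ∈ [0,M₂]^m`, `t < S` and a candidate multi-index with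
entries `≤ T_X`. [folklore] -/
abbrev FamIdx3 (n m' c : ℕ) (X : ℝ) : Type :=
  (Fin (m' + 1) → Fin (M2q n (m' + 1) c X + 1)) × Fin (Sq n (m' + 1) X) ×
    (Var n (m' + 1) → Fin (TX3 n m' X + 1))

/-- The multi-index encoded by the third component of a `FamIdx3`. [folklore] -/
def toJ3 {X : ℝ} (e : Var n (m' + 1) → Fin (TX3 n m' X + 1)) : Var n (m' + 1) →₀ ℕ :=
  Finsupp.equivFunOnFinite.symm fun v => (e v : ℕ)

/-- `toJ3 e v = e v`. [folklore] -/
@[simp] theorem toJ3_apply {X : ℝ} (e : Var n (m' + 1) → Fin (TX3 n m' X + 1)) (v : Var n (m' + 1)) :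
    toJ3 e v = (e v : ℕ) := rfl

open Classical in
/-- The multi-index used for the index `e`: `toJ3 e` if it is good, else `j03`. [folklore] -/
def jOf3 (X : ℝ) (e : Var n (m' + 1) → Fin (TX3 n m' X + 1)) : Var n (m' + 1) →₀ ℕ :=
  if GoodIdx3 y x X (toJ3 e) then toJ3 e else j03 y x X

/-- **The family `𝓕_X = {Q_{l,t,j} ; l ≤ M₂, t < S, j a minimal index at a point of 𝓑_ρ}`** fed to
Philippon's criterion. [folklore] -/
def famPoly3 (c : ℕ) (X : ℝ) (i : FamIdx3 n m' c X) : MvPolynomial (Var n (m' + 1)) ℤ :=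
  Qj (coeffs3 n m' X) (fun k => (i.1 k : ℕ)) (i.2.1 : ℕ) (jOf3 y x X i.2.2)

/-- The `l` of an index has `l ≤ M₂`. [folklore] -/
theorem l_le {c : ℕ} {X : ℝ} (i : FamIdx3 n m' c X) (k : Fin (m' + 1)) :
    (fun k => (i.1 k : ℕ)) k ≤ M2q n (m' + 1) c X := Nat.le_of_lt_succ (i.1 k).isLt

/-- If `coeffs3 ≠ 0`, the multi-index of every member of the family is good. [folklore] -/
theorem goodIdx_jOf3 {X : ℝ} (h : coeffs3 n m' X ≠ 0) (e : Var n (m' + 1) → Fin (TX3 n m' X + 1)) :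
    GoodIdx3 y x X (jOf3 y x X e) := by
  classical
  unfold jOf3
  split_ifs with hg
  · exact hg
  · exact ⟨pt y x, inBall3_pt y x X, isMinIdx_j03 y x h⟩

/-- A minimal index has all its entries `≤ T_X`. [folklore] -/
theorem le_TX3_of_isMinIdx {X : ℝ}
    {p : Unk n (m' + 1) (Dq n (m' + 1) X) (Lq n (m' + 1) X) (bq n (m' + 1) X) → ℤ}
    {θ' : Var n (m' + 1) → ℂ} {j : Var n (m' + 1) →₀ ℕ} (hj : IsMinIdx p θ' j) (v : Var n (m' + 1)) :
    j v ≤ TX3 n m' X :=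
  (Finsupp.le_degree v j).trans (degree_le_of_isMinIdx hj (totalDegree_Pam_le p))

/-- Every good index is the multi-index of some member of the family. [folklore] -/
theorem exists_jOf3_eq {X : ℝ} {j : Var n (m' + 1) →₀ ℕ} (hj : GoodIdx3 y x X j) :
    ∃ e : Var n (m' + 1) → Fin (TX3 n m' X + 1), jOf3 y x X e = j := by
  classical
  obtain ⟨θ', hθ', hmin⟩ := hj
  refine ⟨fun v => ⟨j v, Nat.lt_succ_of_le (le_TX3_of_isMinIdx hmin v)⟩, ?_⟩
  have he : toJ3 (X := X) (fun v => ⟨j v, Nat.lt_succ_of_le (le_TX3_of_isMinIdx hmin v)⟩) = j := by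
    ext v; rfl
  rw [jOf3, he, if_pos ⟨θ', hθ', hmin⟩]

end Family


/-! ### Degrees and lengths of the members of the family -/

section DegLen

variable {c : ℕ} {X : ℝ}

/-- `T̄ ≤ K_T P` at a good `X`. [folklore] -/
theorem Tdeg_le (hn : 1 ≤ n) (h : GoodSize n (m' + 1) c X) :
    (Tdeg n m' c X : ℝ) ≤ KT n m' c * Pw n (m' + 1) X := by
  have hm : 1 ≤ m' + 1 := Nat.succ_pos m'
  obtain ⟨hX1, hlog, hP1, -, -, -, hPl, hPΦ, -, -, -, -, hsP⟩ := atoms hn hm h.hX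
  obtain ⟨hSle, -, hS4, hD, hb, hMle, -, hLle, hL2, -, hM2q, -⟩ := sizes hn hm h
  have haD : (1 : ℝ) ≤ aD n (m' + 1) := by exact_mod_cast one_le_aD (n := n) (m := m' + 1)
  have haB : (0 : ℝ) ≤ aB n (m' + 1) c := Nat.cast_nonneg _
  have hcb : (2 : ℝ) ≤ cb n (m' + 1) := by exact_mod_cast two_le_cb (n := n) (m := m' + 1)
  set V : ℕ := Fintype.card (Var n (m' + 1)) with hV
  set P : ℝ := Pw n (m' + 1) X with hPdef
  have hDP : (Dq n (m' + 1) X : ℝ) ≤ aD n (m' + 1) * P := by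
    rw [hD]; exact mul_le_mul_of_nonneg_left hSle (by positivity)
  unfold Tdeg; rw [← hV]; push_cast
  have t1 : (((bq n (m' + 1) X - 1 : ℕ) : ℝ)) * V ≤ cb n (m' + 1) * V * P := by
    have : (((bq n (m' + 1) X - 1 : ℕ) : ℝ)) ≤ cb n (m' + 1) * P := by
      calc (((bq n (m' + 1) X - 1 : ℕ) : ℝ)) ≤ bq n (m' + 1) X := by exact_mod_cast Nat.sub_le _ _
        _ = cb n (m' + 1) * Sq n (m' + 1) X := hb
        _ ≤ cb n (m' + 1) * P := mul_le_mul_of_nonneg_left hSle (by linarith)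
    calc (((bq n (m' + 1) X - 1 : ℕ) : ℝ)) * V ≤ (cb n (m' + 1) * P) * V :=
          mul_le_mul_of_nonneg_right this (Nat.cast_nonneg _)
      _ = _ := by ring
  have t4 : (n : ℝ) * (((m' + 1 : ℕ) : ℝ)) * Lq n (m' + 1) X * ((M2q n (m' + 1) c X : ℝ) + 1) ≤
      n * ((m' + 1 : ℕ) : ℝ) * (((n : ℝ) + 1) * aB n (m' + 1) c + 1) * P := by
    have hLM : (Lq n (m' + 1) X : ℝ) * ((M2q n (m' + 1) c X : ℝ) + 1) ≤
        (((n : ℝ) + 1) * aB n (m' + 1) c + 1) * P := by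
      rw [hM2q]
      have hs0 : 0 ≤ scale ((((m' + 1 : ℕ) : ℝ)) / n) 0 X := scale_nonneg hX1.le
      have hM1 : ((n : ℝ) + 1) * aB n (m' + 1) c * Mq X + 1 ≤ (((n : ℝ) + 1) * aB n (m' + 1) c + 1) * X := by
        have h1 : ((n : ℝ) + 1) * aB n (m' + 1) c * Mq X ≤ ((n : ℝ) + 1) * aB n (m' + 1) c * X := by gcongr
        nlinarith
      calc (Lq n (m' + 1) X : ℝ) * (((n : ℝ) + 1) * aB n (m' + 1) c * Mq X + 1)
          ≤ scale ((((m' + 1 : ℕ) : ℝ)) / n) 0 X * ((((n : ℝ) + 1) * aB n (m' + 1) c + 1) * X) :=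
            mul_le_mul hLle hM1 (by positivity) hs0
        _ = (((n : ℝ) + 1) * aB n (m' + 1) c + 1) * (scale ((((m' + 1 : ℕ) : ℝ)) / n) 0 X * X) := by ring
        _ = _ := by rw [hsP]
    calc (n : ℝ) * (((m' + 1 : ℕ) : ℝ)) * Lq n (m' + 1) X * ((M2q n (m' + 1) c X : ℝ) + 1)
        = (n : ℝ) * (((m' + 1 : ℕ) : ℝ)) * ((Lq n (m' + 1) X : ℝ) * ((M2q n (m' + 1) c X : ℝ) + 1)) := by ring
      _ ≤ (n : ℝ) * (((m' + 1 : ℕ) : ℝ)) * ((((n : ℝ) + 1) * aB n (m' + 1) c + 1) * P) :=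
          mul_le_mul_of_nonneg_left hLM (by positivity)
      _ = _ := by ring
  rw [KT]
  have t2 : (Sq n (m' + 1) X : ℝ) ≤ 1 * P := by rw [one_mul]; exact hSle
  have hKTexp : (cb n (m' + 1) * (V : ℝ) + 1 + aD n (m' + 1) +
      n * ((m' + 1 : ℕ) : ℝ) * (((n : ℝ) + 1) * aB n (m' + 1) c + 1)) * P =
      cb n (m' + 1) * V * P + 1 * P + aD n (m' + 1) * P +
        n * ((m' + 1 : ℕ) : ℝ) * (((n : ℝ) + 1) * aB n (m' + 1) c + 1) * P := by ring
  rw [hKTexp]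
  push_cast at t1 t2 hDP t4 ⊢
  linarith [t1, t2, hDP, t4]

/-- The constant of the length bound `log L(Q_{l,t,j}) ≤ K_len Φ`. [folklore] -/
def Klen (n m' c : ℕ) : ℝ :=
  KAM n (m' + 1) + KC n (m' + 1) 1 + (Real.log (aD n (m' + 1) + n) + 1 + (((m' + 1 : ℕ) : ℝ)) / n) +
    aD n (m' + 1) * (Real.log (((m' + 1 : ℕ) : ℝ) * (((n : ℝ) + 1) * aB n (m' + 1) c + 1) + 1) + 1)

set_option maxHeartbeats 800000 in
/-- **Degrees and lengths of the members of the family at a good `X`**: for `|p| ≤ H`, `l ≤ M₂`,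
`t < S` and any `j`, `deg Q_{l,t,j} ≤ K_T P` and `log L(Q_{l,t,j}) ≤ K_len Φ`. [folklore] -/
theorem degLen_at (hn : 1 ≤ n) (h : GoodSize n (m' + 1) c X)
    (p : Unk n (m' + 1) (Dq n (m' + 1) X) (Lq n (m' + 1) X) (bq n (m' + 1) X) → ℤ)
    (hH : ∀ w, |(p w : ℝ)| ≤ Hgt3 n (m' + 1) X) (l : Fin (m' + 1) → ℕ)
    (hl : ∀ k, l k ≤ M2q n (m' + 1) c X) (t : ℕ) (ht : t < Sq n (m' + 1) X) (j : Var n (m' + 1) →₀ ℕ) :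
    ((Qj p l t j).totalDegree : ℝ) ≤ KT n m' c * Pw n (m' + 1) X ∧
      Real.log (l1 (Qj p l t j)) ≤ Klen n m' c * Phi3 n (m' + 1) X := by
  have hm : 1 ≤ m' + 1 := Nat.succ_pos m'
  obtain ⟨hX1, hlog, hP1, -, -, -, hPl, hPΦ, -, -, -, -, hsP⟩ := atoms hn hm h.hX
  obtain ⟨hSle, -, hS4, hD, hb, hMle, -, hLle, hL2, -, hM2q, -⟩ := sizes hn hm h
  have hXpos : 0 < X := by linarith
  have hl' : ∀ k, l k < M2q n (m' + 1) c X + 1 := fun k => Nat.lt_succ_of_le (hl k)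
  constructor
  · -- degree
    have h1 := totalDegree_Qj_le p hl' t j
    have hT : (bq n (m' + 1) X - 1) * Fintype.card (Var n (m' + 1)) +
        (t + Dq n (m' + 1) X + n * (m' + 1) * Lq n (m' + 1) X * (M2q n (m' + 1) c X + 1)) ≤ Tdeg n m' c X := by
      unfold Tdeg; omega
    calc ((Qj p l t j).totalDegree : ℝ) ≤ Tdeg n m' c X := by exact_mod_cast h1.trans hT
      _ ≤ KT n m' c * Pw n (m' + 1) X := Tdeg_le hn h
  · -- length
    have haD : (1 : ℝ) ≤ aD n (m' + 1) := by exact_mod_cast one_le_aD (n := n) (m := m' + 1)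
    have haB : (0 : ℝ) ≤ aB n (m' + 1) c := Nat.cast_nonneg _
    have hn1 : (1 : ℝ) ≤ n := by exact_mod_cast hn
    set P : ℝ := Pw n (m' + 1) X with hPdef
    set Φ : ℝ := Phi3 n (m' + 1) X with hΦdef
    have hP0 : 0 < P := by linarith
    have hΦ1 : 1 ≤ Φ := hP1.trans hPΦ
    have hlogP : Real.log P = (1 + (((m' + 1 : ℕ) : ℝ)) / n) * Real.log X := by
      rw [hPdef, Pw, scale_zero_eq_exp _ hXpos, Real.log_exp]
    have hsP' : scale ((((m' + 1 : ℕ) : ℝ)) / n) 0 X ≤ P := by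
      rw [hPdef, Pw]; exact scale_le_scale (by linarith) le_rfl h.hX
    have hlen := l1_Qj_le p hH hl' t j
    -- the four factors
    have hAM0 := cardAM_pos hn h
    have b1 := log_cardAM_le hn h
    have hC0 := Ccoef_pos h.H1 (one_le_bq hn h) le_rfl
    have hCeq : (2 : ℝ) ^ ((bq n (m' + 1) X - 1) * Fintype.card (Var n (m' + 1))) *
        (Fintype.card (ExpIdx n (m' + 1) (bq n (m' + 1) X)) * Hgt3 n (m' + 1) X) = Ccoef n m' 1 X := by
      rw [Ccoef, one_pow, mul_one]
    have b2 : Real.log ((2 : ℝ) ^ ((bq n (m' + 1) X - 1) * Fintype.card (Var n (m' + 1))) *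
        (Fintype.card (ExpIdx n (m' + 1) (bq n (m' + 1) X)) * Hgt3 n (m' + 1) X)) ≤ KC n (m' + 1) 1 * Φ := by
      rw [hCeq]; exact log_Ccoef_le hn h le_rfl
    have hDnL : ((Dq n (m' + 1) X : ℝ)) + n * Lq n (m' + 1) X ≤ (aD n (m' + 1) + n) * P := by
      rw [hD]
      have e1 : (aD n (m' + 1) : ℝ) * Sq n (m' + 1) X ≤ aD n (m' + 1) * P := mul_le_mul_of_nonneg_left hSle (by positivity)
      have e2 : (n : ℝ) * Lq n (m' + 1) X ≤ n * P := mul_le_mul_of_nonneg_left (hLle.trans hsP') (by positivity)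
      linarith
    have hDnL1 : (1 : ℝ) ≤ ((Dq n (m' + 1) X : ℝ)) + n * Lq n (m' + 1) X := by
      have : (1 : ℝ) ≤ Dq n (m' + 1) X := by
        rw [hD]; have hS1 : (1 : ℝ) ≤ Sq n (m' + 1) X := by exact_mod_cast (show 1 ≤ Sq n (m' + 1) X by omega)
        nlinarith
      have : (0 : ℝ) ≤ n * Lq n (m' + 1) X := by positivity
      linarith
    have hlDnL : Real.log (((Dq n (m' + 1) X : ℝ)) + n * Lq n (m' + 1) X) ≤
        Real.log (aD n (m' + 1) + n) + (1 + (((m' + 1 : ℕ) : ℝ)) / n) * Real.log X := by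
      rw [← hlogP, ← Real.log_mul (by positivity) hP0.ne']
      exact Real.log_le_log (by linarith) hDnL
    have hlaDn : 0 ≤ Real.log (aD n (m' + 1) + n) := Real.log_nonneg (by linarith)
    have htS : (t : ℝ) ≤ Sq n (m' + 1) X := by exact_mod_cast ht.le
    have b3 : (t : ℝ) * Real.log (((Dq n (m' + 1) X : ℝ)) + n * Lq n (m' + 1) X) ≤
        (Real.log (aD n (m' + 1) + n) + 1 + (((m' + 1 : ℕ) : ℝ)) / n) * Φ := by
      calc (t : ℝ) * Real.log (((Dq n (m' + 1) X : ℝ)) + n * Lq n (m' + 1) X)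
          ≤ P * (Real.log (aD n (m' + 1) + n) + (1 + (((m' + 1 : ℕ) : ℝ)) / n) * Real.log X) :=
            mul_le_mul (htS.trans hSle) hlDnL (Real.log_nonneg hDnL1) hP0.le
        _ = P * Real.log (aD n (m' + 1) + n) + (1 + (((m' + 1 : ℕ) : ℝ)) / n) * Φ := by rw [← hPl]; ring
        _ ≤ Φ * Real.log (aD n (m' + 1) + n) + (1 + (((m' + 1 : ℕ) : ℝ)) / n) * Φ := by gcongr
        _ = _ := by ring
    set c₄ : ℝ := ((m' + 1 : ℕ) : ℝ) * (((n : ℝ) + 1) * aB n (m' + 1) c + 1) + 1 with hc₄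
    have hc₄1 : 1 ≤ c₄ := by
      rw [hc₄]; linarith [(by positivity : (0 : ℝ) ≤ ((m' + 1 : ℕ) : ℝ) * (((n : ℝ) + 1) * aB n (m' + 1) c + 1))]
    have hMM : (((m' + 1 : ℕ) : ℝ)) * ((M2q n (m' + 1) c X + 1 : ℕ) : ℝ) + 1 ≤ c₄ * X := by
      have hc : ((M2q n (m' + 1) c X + 1 : ℕ) : ℝ) = (M2q n (m' + 1) c X : ℝ) + 1 := by push_cast; ring
      rw [hc, hM2q, hc₄]
      have h1 : ((n : ℝ) + 1) * aB n (m' + 1) c * Mq X ≤ ((n : ℝ) + 1) * aB n (m' + 1) c * X := by gcongr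
      have h2 : (1 : ℝ) ≤ X := hX1.le
      have h3 : (0 : ℝ) ≤ ((m' + 1 : ℕ) : ℝ) := Nat.cast_nonneg _
      have h4 : ((n : ℝ) + 1) * aB n (m' + 1) c * Mq X + 1 ≤ (((n : ℝ) + 1) * aB n (m' + 1) c + 1) * X := by
        nlinarith
      have h5 := mul_le_mul_of_nonneg_left h4 h3
      have h6 : (((m' + 1 : ℕ) : ℝ)) * ((((n : ℝ) + 1) * aB n (m' + 1) c + 1) * X) + 1 ≤
          ((((m' + 1 : ℕ) : ℝ)) * (((n : ℝ) + 1) * aB n (m' + 1) c + 1) + 1) * X := by nlinarith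
      linarith
    have hMM0 : 0 < (((m' + 1 : ℕ) : ℝ)) * ((M2q n (m' + 1) c X + 1 : ℕ) : ℝ) + 1 := by positivity
    have hlMM : Real.log ((((m' + 1 : ℕ) : ℝ)) * ((M2q n (m' + 1) c X + 1 : ℕ) : ℝ) + 1) ≤ Real.log c₄ + Real.log X := by
      rw [← Real.log_mul (by positivity) hXpos.ne']; exact Real.log_le_log hMM0 hMM
    have hlc₄ : 0 ≤ Real.log c₄ := Real.log_nonneg hc₄1
    have hDP : (Dq n (m' + 1) X : ℝ) ≤ aD n (m' + 1) * P := by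
      rw [hD]; exact mul_le_mul_of_nonneg_left hSle (by positivity)
    have b4 : (Dq n (m' + 1) X : ℝ) * Real.log ((((m' + 1 : ℕ) : ℝ)) * ((M2q n (m' + 1) c X + 1 : ℕ) : ℝ) + 1) ≤
        aD n (m' + 1) * (Real.log c₄ + 1) * Φ := by
      calc _ ≤ (aD n (m' + 1) * P) * (Real.log c₄ + Real.log X) :=
            mul_le_mul hDP hlMM (Real.log_nonneg (by linarith [(by positivity : (0:ℝ) ≤ (((m' + 1 : ℕ) : ℝ)) * ((M2q n (m' + 1) c X + 1 : ℕ) : ℝ))])) (by positivity)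
        _ = aD n (m' + 1) * (P * Real.log c₄ + Φ) := by rw [← hPl]; ring
        _ ≤ aD n (m' + 1) * (Φ * Real.log c₄ + Φ) := by gcongr
        _ = _ := by ring
    -- the bound on `L(Q)` and its logarithm
    set Bnd : ℝ := (Fintype.card (AM n (Dq n (m' + 1) X) (Lq n (m' + 1) X)) : ℝ) *
        ((2 : ℝ) ^ ((bq n (m' + 1) X - 1) * Fintype.card (Var n (m' + 1))) *
          (Fintype.card (ExpIdx n (m' + 1) (bq n (m' + 1) X)) * Hgt3 n (m' + 1) X)) *
        ((((Dq n (m' + 1) X : ℝ)) + n * Lq n (m' + 1) X) ^ t *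
          ((((m' + 1 : ℕ) : ℝ)) * ((M2q n (m' + 1) c X + 1 : ℕ) : ℝ) + 1) ^ Dq n (m' + 1) X) with hBnd
    have hlenB : l1 (Qj p l t j) ≤ Bnd := hlen.trans (le_of_eq (by rw [hBnd]; ring))
    have hFC0 : (0 : ℝ) < (2 : ℝ) ^ ((bq n (m' + 1) X - 1) * Fintype.card (Var n (m' + 1))) *
        (Fintype.card (ExpIdx n (m' + 1) (bq n (m' + 1) X)) * Hgt3 n (m' + 1) X) := by rw [hCeq]; exact hC0
    have hFDL0 : (0 : ℝ) < ((((Dq n (m' + 1) X : ℝ)) + n * Lq n (m' + 1) X) ^ t) := by positivity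
    have hFM0 : (0 : ℝ) < ((((m' + 1 : ℕ) : ℝ)) * ((M2q n (m' + 1) c X + 1 : ℕ) : ℝ) + 1) ^ Dq n (m' + 1) X := by
      positivity
    have hBpos : 0 < Bnd := by rw [hBnd]; exact mul_pos (mul_pos hAM0 hFC0) (mul_pos hFDL0 hFM0)
    have hlogB : Real.log Bnd ≤ Klen n m' c * Φ := by
      rw [hBnd, Real.log_mul (mul_pos hAM0 hFC0).ne' (mul_pos hFDL0 hFM0).ne', Real.log_mul hAM0.ne' hFC0.ne',
        Real.log_mul hFDL0.ne' hFM0.ne', Real.log_pow, Real.log_pow, Klen, ← hc₄]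
      linarith [b1, b2, b3, b4]
    have hl0 : 0 ≤ l1 (Qj p l t j) := wnorm_nonneg _ _
    rcases eq_or_lt_of_le hl0 with h0 | hpos
    · rw [← h0, Real.log_zero]
      have hK0 : 0 ≤ Klen n m' c * Φ := by
        have hKAM : 0 ≤ KAM n (m' + 1) := by
          rw [KAM]; have := Real.log_nonneg haD; positivity
        have hKC : 0 ≤ KC n (m' + 1) 1 := by
          rw [KC, Real.log_one, add_zero]
          have h2 : 0 ≤ Real.log 2 := Real.log_nonneg (by norm_num)
          have hcb : (2 : ℝ) ≤ cb n (m' + 1) := by exact_mod_cast two_le_cb (n := n) (m := m' + 1)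
          have h3 : 0 ≤ Real.log (cb n (m' + 1)) := Real.log_nonneg (by linarith)
          have hKH : 0 ≤ KH n (m' + 1) := by rw [KH]; positivity
          positivity
        rw [Klen, ← hc₄]; positivity
      exact hK0
    · exact (Real.log_le_log hpos hlenB).trans hlogB

end DegLen


/-! ### The eventual facts at `X`, bundled, and the properties of the family -/

section GoodX

variable (y : Fin n → ℂ) (x : Fin (m' + 1) → ℂ)

/-- The facts, valid for all large `X`, that the assembly uses at level `X`: good sizes, Siegel's
margin (𝒞1), the smallness of the family at `θ` (`eventually_small3`), the degree and length bounds
by `X^{a₁}` (`a₁ > 1 + m/n`), no common zero in the ball (`eventually_zeroFree3`), `S ≥ 1` and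
`X ≥ 3`. [folklore] -/
structure GoodX3 (a₁ : ℝ) (c : ℕ) (X : ℝ) : Prop where
  gs : GoodSize n (m' + 1) c X
  three_le : 3 ≤ X
  C1 : 2 * (Mq X ^ (m' + 1) * (Sq n (m' + 1) X * (bq n (m' + 1) X +
      (Sq n (m' + 1) X + Dq n (m' + 1) X + n * (m' + 1) * Lq n (m' + 1) X * Mq X)) ^
        Fintype.card (Var n (m' + 1)))) ≤
      Dq n (m' + 1) X * Lq n (m' + 1) X ^ n * bq n (m' + 1) X ^ Fintype.card (Var n (m' + 1))
  small : ∀ (p : Unk n (m' + 1) (Dq n (m' + 1) X) (Lq n (m' + 1) X) (bq n (m' + 1) X) → ℤ),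
      (∀ w, |(p w : ℝ)| ≤ Hgt3 n (m' + 1) X) →
      (∀ l : Fin (m' + 1) → ℕ, (∀ k, l k < Mq X) → ∀ t < Sq n (m' + 1) X, Q p l t = 0) →
      ∀ θ' : Var n (m' + 1) → ℂ, (∀ v, ‖θ' v - pt y x v‖ ≤ Real.exp (-rho3 n (m' + 1) X)) →
      ∀ j : Var n (m' + 1) →₀ ℕ, IsMinIdx p θ' j →
      ∀ l : Fin (m' + 1) → ℕ, (∀ k, l k ≤ M2q n (m' + 1) c X) → ∀ t < Sq n (m' + 1) X,
        ‖aeval (pt y x) (Qj p l t j)‖ ≤ Real.exp (-(Psi3 n (m' + 1) X / 2 ^ (m' + 5)))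
  degLen : ∀ (p : Unk n (m' + 1) (Dq n (m' + 1) X) (Lq n (m' + 1) X) (bq n (m' + 1) X) → ℤ),
      (∀ w, |(p w : ℝ)| ≤ Hgt3 n (m' + 1) X) → ∀ l : Fin (m' + 1) → ℕ,
      (∀ k, l k ≤ M2q n (m' + 1) c X) → ∀ t < Sq n (m' + 1) X, ∀ j : Var n (m' + 1) →₀ ℕ,
        ((Qj p l t j).totalDegree : ℝ) ≤ scale a₁ 0 X ∧ Real.log (l1 (Qj p l t j)) ≤ scale a₁ 0 X
  zeroFree : ∀ (p : Unk n (m' + 1) (Dq n (m' + 1) X) (Lq n (m' + 1) X) (bq n (m' + 1) X) → ℤ)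
      (θ' : Var n (m' + 1) → ℂ), (∀ v, ‖θ' v - pt y x v‖ ≤ Real.exp (-rho3 n (m' + 1) X)) →
      ∀ j : Var n (m' + 1) →₀ ℕ, IsMinIdx p θ' j →
        ∃ (l : Fin (m' + 1) → ℕ) (t : ℕ), (∀ k, l k ≤ M2q n (m' + 1) c X) ∧
          t ≤ T2q n (m' + 1) X ∧ aeval θ' (Qj p l t j) ≠ 0
  S_ge : 1 ≤ Psi3 n (m' + 1) X / 2 ^ (m' + 5)

/-- **All large `X` are good**, given the eventual smallness and zero-freeness. [folklore] -/
theorem eventually_goodX3 (hn : 1 ≤ n) {a₁ : ℝ} (ha₁ : 1 + (((m' + 1 : ℕ) : ℝ)) / n < a₁) (c : ℕ)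
    (hsmall : ∀ᶠ X in atTop,
      ∀ (p : Unk n (m' + 1) (Dq n (m' + 1) X) (Lq n (m' + 1) X) (bq n (m' + 1) X) → ℤ),
      (∀ w, |(p w : ℝ)| ≤ Hgt3 n (m' + 1) X) →
      (∀ l : Fin (m' + 1) → ℕ, (∀ k, l k < Mq X) → ∀ t < Sq n (m' + 1) X, Q p l t = 0) →
      ∀ θ' : Var n (m' + 1) → ℂ, (∀ v, ‖θ' v - pt y x v‖ ≤ Real.exp (-rho3 n (m' + 1) X)) →
      ∀ j : Var n (m' + 1) →₀ ℕ, IsMinIdx p θ' j →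
      ∀ l : Fin (m' + 1) → ℕ, (∀ k, l k ≤ M2q n (m' + 1) c X) → ∀ t < Sq n (m' + 1) X,
        ‖aeval (pt y x) (Qj p l t j)‖ ≤ Real.exp (-(Psi3 n (m' + 1) X / 2 ^ (m' + 5))))
    (hzf : ∀ᶠ X in atTop,
      ∀ (p : Unk n (m' + 1) (Dq n (m' + 1) X) (Lq n (m' + 1) X) (bq n (m' + 1) X) → ℤ)
        (θ' : Var n (m' + 1) → ℂ), (∀ v, ‖θ' v - pt y x v‖ ≤ Real.exp (-rho3 n (m' + 1) X)) →
        ∀ j : Var n (m' + 1) →₀ ℕ, IsMinIdx p θ' j →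
          ∃ (l : Fin (m' + 1) → ℕ) (t : ℕ), (∀ k, l k ≤ M2q n (m' + 1) c X) ∧
            t ≤ T2q n (m' + 1) X ∧ aeval θ' (Qj p l t j) ≠ 0) :
    ∀ᶠ X in atTop, GoodX3 y x a₁ c X := by
  have hm : 1 ≤ m' + 1 := Nat.succ_pos m'
  have hpos : (0 : ℝ) < 1 + (((m' + 1 : ℕ) : ℝ)) / n + ((m' + 1 : ℕ) : ℝ) := by positivity
  have h1 := eventually_mul_scale_le_of_lt ha₁ 0 0 (KT n m' c)
  have h2 := eventually_mul_scale_le_of_lt ha₁ 1 0 (Klen n m' c)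
  have h3 := eventually_const_le_scale (a := 1 + (((m' + 1 : ℕ) : ℝ)) / n + ((m' + 1 : ℕ) : ℝ)) (b := 1)
    (Or.inl hpos) ((2 : ℝ) ^ (m' + 5))
  filter_upwards [eventually_goodSize (n := n) hn hm c, eventually_ge_atTop (3 : ℝ),
    eventually_C1 (n := n) (m := m' + 1) hn hm, hsmall, h1, h2, hzf, h3] with X hG h3X hC1 hsm h1X h2X hz h3X'
  refine ⟨hG, h3X, hC1, hsm, fun p hp l hl t ht j => ?_, hz, ?_⟩
  · obtain ⟨hd, hlen⟩ := degLen_at hn hG p hp l hl t ht j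
    exact ⟨hd.trans h1X, hlen.trans h2X⟩
  · rw [le_div_iff₀ (by positivity), one_mul]; exact h3X'

variable {y x}

/-- At a good `X`, Siegel's coefficients are non-trivial, bounded by `H`, and kill the `Q_{l,t}`,
`l ∈ [0,M)^m`, `t < S`. [folklore] -/
theorem GoodX3.coeffs {a₁ : ℝ} {c : ℕ} {X : ℝ} (hn : 1 ≤ n) (hG : GoodX3 y x a₁ c X) :
    coeffs3 n m' X ≠ 0 ∧ (∀ w, |(coeffs3 n m' X w : ℝ)| ≤ Hgt3 n (m' + 1) X) ∧
      ∀ l : Fin (m' + 1) → ℕ, (∀ k, l k < Mq X) → ∀ t < Sq n (m' + 1) X, Q (coeffs3 n m' X) l t = 0 := by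
  have hm : 1 ≤ m' + 1 := Nat.succ_pos m'
  obtain ⟨-, -, hS4, -⟩ := sizes hn hm hG.gs
  have hS1 : 1 ≤ Sq n (m' + 1) X := by omega
  have hD1 : 1 ≤ Dq n (m' + 1) X := by
    unfold Dq; exact le_trans hS1 (Nat.le_mul_of_pos_left _ (lt_of_lt_of_le one_pos one_le_aD))
  exact coeffs3_spec hD1 (le_trans (by norm_num) hG.gs.M2) hS1 hG.C1

/-- **All members of the family are small at `θ`**: `|Q(θ)| ≤ exp(-Ψ/2^{m+4})`. [folklore] -/
theorem GoodX3.small_famPoly {a₁ : ℝ} {c : ℕ} {X : ℝ} (hn : 1 ≤ n) (hG : GoodX3 y x a₁ c X)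
    (i : FamIdx3 n m' c X) :
    ‖aeval (pt y x) (famPoly3 y x c X i)‖ ≤ Real.exp (-(Psi3 n (m' + 1) X / 2 ^ (m' + 5))) := by
  obtain ⟨h0, hb, hv0⟩ := hG.coeffs hn
  obtain ⟨θ', hθ', hmin⟩ := goodIdx_jOf3 y x h0 i.2.2
  exact hG.small _ hb hv0 θ' hθ' _ hmin _ (l_le i) _ i.2.1.isLt

/-- Degrees and lengths of the members of the family: `deg Q ≤ X^{a₁}`, `log L(Q) ≤ X^{a₁}`.
[folklore] -/
theorem GoodX3.degLen_famPoly {a₁ : ℝ} {c : ℕ} {X : ℝ} (hn : 1 ≤ n) (hG : GoodX3 y x a₁ c X)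
    (i : FamIdx3 n m' c X) :
    ((famPoly3 y x c X i).totalDegree : ℝ) ≤ scale a₁ 0 X ∧
      Real.log (l1 (famPoly3 y x c X i)) ≤ scale a₁ 0 X := by
  obtain ⟨-, hb, -⟩ := hG.coeffs hn
  exact hG.degLen _ hb _ (l_le i) _ i.2.1.isLt _

/-- **No common zero of the family in the ball `𝓑_ρ`.** [folklore] -/
theorem GoodX3.exists_ne_zero {a₁ : ℝ} {c : ℕ} {X : ℝ} (hn : 1 ≤ n) (hG : GoodX3 y x a₁ c X)
    {θ' : Var n (m' + 1) → ℂ} (hθ' : InBall3 y x X θ') :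
    ∃ i : FamIdx3 n m' c X, aeval θ' (famPoly3 y x c X i) ≠ 0 := by
  obtain ⟨h0, -, -⟩ := hG.coeffs hn
  have hm : 1 ≤ m' + 1 := Nat.succ_pos m'
  obtain ⟨-, -, hS4, -⟩ := sizes hn hm hG.gs
  obtain ⟨j, hj⟩ := exists_isMinIdx h0 θ'
  obtain ⟨l, t, hl, ht, hne⟩ := hG.zeroFree _ θ' hθ' j hj
  obtain ⟨e, he⟩ := exists_jOf3_eq y x ⟨θ', hθ', hj⟩
  have htS : t < Sq n (m' + 1) X := lt_of_le_of_lt ht (T2_lt_S (by omega))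
  refine ⟨(fun k => ⟨l k, Nat.lt_succ_of_le (hl k)⟩, ⟨t, htS⟩, e), ?_⟩
  simpa [famPoly3, he] using hne

/-- Some member of the family does not vanish at `θ`. [folklore] -/
theorem GoodX3.exists_ne_zero_pt {a₁ : ℝ} {c : ℕ} {X : ℝ} (hn : 1 ≤ n) (hG : GoodX3 y x a₁ c X) :
    ∃ i : FamIdx3 n m' c X, aeval (pt y x) (famPoly3 y x c X i) ≠ 0 :=
  hG.exists_ne_zero hn (inBall3_pt y x X)

end GoodX


/-! ### Transport of the variables to `Fin q` -/

/-- `Var n m ≃ Fin (n + (m + nm))` (the criterion is stated for polynomials in `X₁, …, X_q`).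
[folklore] -/
def varEquiv3 (n m : ℕ) : Var n m ≃ Fin (n + (m + n * m)) :=
  (Equiv.sumCongr (Equiv.refl (Fin n))
    ((Equiv.sumCongr (Equiv.refl (Fin m)) finProdFinEquiv).trans finSumFinEquiv)).trans finSumFinEquiv

/-! ### The functions `σ = δ`, `R`, `S` of the criterion -/

/-- `σ(N) = δ(N) = X_N^{a₁}`, `X_N = N + N₁` (degrees and logarithmic lengths). [folklore] -/
def sigF3 (a₁ : ℝ) (N₁ : ℕ) (N : ℕ) : ℝ := scale a₁ 0 ((N : ℝ) + N₁)

/-- `R(N) = ρ(X_N)` (radius `e^{-R}` of the ball). [folklore] -/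
def RF3 (n m' N₁ : ℕ) (N : ℕ) : ℝ := rho3 n (m' + 1) ((N : ℝ) + N₁)

/-- `S(N) = Ψ(X_N)/2^{m+4}` (smallness). [folklore] -/
def SF3 (n m' N₁ : ℕ) (N : ℕ) : ℝ := Psi3 n (m' + 1) ((N : ℝ) + N₁) / 2 ^ (m' + 5)

section Growth

variable {N₁ : ℕ} (hN₁ : 3 ≤ N₁)
include hN₁

/-- `σ` is non-decreasing (`a₁ ≥ 0`). [folklore] -/
theorem sigF3_mono {a₁ : ℝ} (ha₁ : 0 ≤ a₁) : Monotone (sigF3 a₁ N₁) := by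
  intro a b hab
  unfold sigF3
  exact scale_mono ha₁ le_rfl (by linarith [three_le_X hN₁ a]) (by simpa using (Nat.cast_le (α := ℝ)).mpr hab)

/-- `R` is non-decreasing. [folklore] -/
theorem RF3_mono : Monotone (RF3 n m' N₁) := by
  intro a b hab
  unfold RF3 rho3 Psi3
  refine mul_le_mul_of_nonneg_left (scale_mono (by positivity) zero_le_one
    (by linarith [three_le_X hN₁ a]) (by simpa using (Nat.cast_le (α := ℝ)).mpr hab)) (by norm_num)

/-- `S` is non-decreasing. [folklore] -/
theorem SF3_mono : Monotone (SF3 n m' N₁) := by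
  intro a b hab
  unfold SF3 Psi3
  exact div_le_div_of_nonneg_right (scale_mono (by positivity) zero_le_one
    (by linarith [three_le_X hN₁ a]) (by simpa using (Nat.cast_le (α := ℝ)).mpr hab)) (by positivity)

/-- `σ ≥ X_N` (`a₁ ≥ 1`). [folklore] -/
theorem X_le_sigF3 {a₁ : ℝ} (ha₁ : 1 ≤ a₁) (N : ℕ) : (N : ℝ) + N₁ ≤ sigF3 a₁ N₁ N := by
  unfold sigF3 scale
  rw [Real.rpow_zero, mul_one]
  have hX : (1 : ℝ) ≤ (N : ℝ) + N₁ := by linarith [three_le_X hN₁ N]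
  calc (N : ℝ) + N₁ = ((N : ℝ) + N₁) ^ (1 : ℝ) := (Real.rpow_one _).symm
    _ ≤ ((N : ℝ) + N₁) ^ a₁ := Real.rpow_le_rpow_of_exponent_le hX ha₁

/-- `σ ≥ 1` (`a₁ ≥ 1`). [folklore] -/
theorem one_le_sigF3 {a₁ : ℝ} (ha₁ : 1 ≤ a₁) (N : ℕ) : 1 ≤ sigF3 a₁ N₁ N :=
  le_trans (by linarith [three_le_X hN₁ N]) (X_le_sigF3 hN₁ ha₁ N)

/-- `R ≥ 1`. [folklore] -/
theorem one_le_RF3 (N : ℕ) : 1 ≤ RF3 n m' N₁ N := by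
  unfold RF3 rho3 Psi3
  have h1 : 1 ≤ scale (1 + (((m' + 1 : ℕ) : ℝ)) / n + ((m' + 1 : ℕ) : ℝ)) 1 ((N : ℝ) + N₁) :=
    one_le_scale (by positivity) zero_le_one (exp_one_le_X hN₁ N)
  linarith

/-- `σ + δ → ∞` (`a₁ ≥ 1`). [folklore] -/
theorem tendsto_sigF3 {a₁ : ℝ} (ha₁ : 1 ≤ a₁) :
    Tendsto (fun N => sigF3 a₁ N₁ N + sigF3 a₁ N₁ N) atTop atTop := by
  refine tendsto_atTop_mono (fun N => ?_) tendsto_natCast_atTop_atTop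
  have h1 := X_le_sigF3 hN₁ ha₁ N
  have h2 : (0 : ℝ) ≤ N₁ := Nat.cast_nonneg N₁
  linarith

/-- **The quotient `S/((σ+δ)δ^k)` is the scale `2^{-(m+5)} X^{A-(k+1)a₁} log X`.** [folklore] -/
theorem ratio_eq3 {a₁ : ℝ} {k : ℕ} (N : ℕ) :
    SF3 n m' N₁ N / ((sigF3 a₁ N₁ N + sigF3 a₁ N₁ N) * sigF3 a₁ N₁ N ^ k) =
      (1 / 2 ^ (m' + 6)) * scale ((1 + (((m' + 1 : ℕ) : ℝ)) / n + ((m' + 1 : ℕ) : ℝ)) - a₁ * ((k : ℝ) + 1)) 1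
        ((N : ℝ) + N₁) := by
  set X : ℝ := (N : ℝ) + N₁ with hXdef
  have hX1 : 1 < X := by linarith [three_le_X hN₁ N]
  unfold SF3 sigF3
  rw [← hXdef]
  have e1 : (scale a₁ 0 X + scale a₁ 0 X) * scale a₁ 0 X ^ k = 2 * scale a₁ 0 X ^ (k + 1) := by ring
  rw [e1, scale_pow hX1.le, Psi3]
  have hs : 0 < scale (a₁ * ((k + 1 : ℕ) : ℝ)) (0 * ((k + 1 : ℕ) : ℝ)) X := scale_pos hX1
  have h2 : (0 : ℝ) < 2 ^ (m' + 5) := by positivity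
  rw [div_div, show (2 : ℝ) ^ (m' + 5) * (2 * scale (a₁ * ((k + 1 : ℕ) : ℝ)) (0 * ((k + 1 : ℕ) : ℝ)) X) =
    2 ^ (m' + 6) * scale (a₁ * ((k + 1 : ℕ) : ℝ)) (0 * ((k + 1 : ℕ) : ℝ)) X by rw [pow_succ]; ring]
  rw [mul_comm ((2 : ℝ) ^ (m' + 6)), ← div_div, scale_div_scale hX1]
  push_cast
  rw [zero_mul, sub_zero]
  ring_nf

/-- The quotient `S/((σ+δ)δ^k)` is non-decreasing when `(k+1)a₁ ≤ A = 1 + m/n + m`. [folklore] -/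
theorem ratio_mono3 {a₁ : ℝ} {k : ℕ}
    (hk : a₁ * ((k : ℝ) + 1) ≤ 1 + (((m' + 1 : ℕ) : ℝ)) / n + ((m' + 1 : ℕ) : ℝ)) :
    Monotone fun N => SF3 n m' N₁ N / ((sigF3 a₁ N₁ N + sigF3 a₁ N₁ N) * sigF3 a₁ N₁ N ^ k) := by
  intro a b hab
  simp only [ratio_eq3 hN₁]
  refine mul_le_mul_of_nonneg_left (scale_mono (by linarith) zero_le_one (by linarith [three_le_X hN₁ a])
    (by simpa using (Nat.cast_le (α := ℝ)).mpr hab)) (by positivity)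

end Growth

/-! ### The main inequality `S^{k+2} ≥ C(σ+δ)δ^k(S^{k+1} + R^{k+1})` of the criterion -/

/-- The constant `K` of the main inequality: with `g = 2^{a₁}`, `g' = 2^{A+1}`,
`K = 2C g^{k+1}(1 + (4g'2^{m+4})^{k+1})·2^{m+4}`. [folklore] -/
def Kmain3 (m' k : ℕ) (C a₁ A : ℝ) : ℝ :=
  2 * C * ((2 : ℝ) ^ a₁) ^ (k + 1) * (1 + (4 * (2 : ℝ) ^ (A + 1) * (2 : ℝ) ^ (m' + 5)) ^ (k + 1)) *
    (2 : ℝ) ^ (m' + 5)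

/-- **The main inequality of the criterion at `X`**, from the domination `K X^{(k+1)a₁} ≤ Ψ(X)`
(the values at `X + 1` are at most `2^{a+b}` times those at `X`). [folklore] -/
theorem main_ineq_at3 {k : ℕ} {C a₁ X : ℝ} (hC : 1 ≤ C) (ha₁ : 0 ≤ a₁) (hX : 2 ≤ X)
    (hE : Kmain3 m' k C a₁ (1 + (((m' + 1 : ℕ) : ℝ)) / n + ((m' + 1 : ℕ) : ℝ)) * scale (a₁ * ((k : ℝ) + 1)) 0 X ≤
      Psi3 n (m' + 1) X) :
    C * (scale a₁ 0 (X + 1) + scale a₁ 0 (X + 1)) * scale a₁ 0 (X + 1) ^ k *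
        ((Psi3 n (m' + 1) X / 2 ^ (m' + 5)) ^ (k + 1) + rho3 n (m' + 1) (X + 1) ^ (k + 1)) ≤
      (Psi3 n (m' + 1) X / 2 ^ (m' + 5)) ^ (k + 2) := by
  have hX1 : 1 ≤ X := by linarith
  set A : ℝ := 1 + (((m' + 1 : ℕ) : ℝ)) / n + ((m' + 1 : ℕ) : ℝ) with hA
  have hA0 : 0 ≤ A := by rw [hA]; positivity
  set g : ℝ := (2 : ℝ) ^ a₁ with hg
  set g' : ℝ := (2 : ℝ) ^ (A + 1) with hg'
  set Ψ : ℝ := Psi3 n (m' + 1) X with hΨ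
  set σX : ℝ := scale a₁ 0 X with hσ
  set T : ℝ := (2 : ℝ) ^ (m' + 5) with hT
  have hT0 : 0 < T := by rw [hT]; positivity
  set s : ℝ := Ψ / T with hsdef
  have hΨ0 : 0 ≤ Ψ := scale_nonneg hX1
  have hσ0 : 0 ≤ σX := scale_nonneg hX1
  have hs0 : 0 ≤ s := div_nonneg hΨ0 hT0.le
  have hΨs : Ψ = T * s := by rw [hsdef]; field_simp
  have hσ1 : scale a₁ 0 (X + 1) ≤ g * σX := by
    have := scale_add_one_le ha₁ le_rfl hX (b := 0)
    simpa [hg] using this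
  have hΨ1 : Psi3 n (m' + 1) (X + 1) ≤ g' * Ψ := by
    have := scale_add_one_le (a := A) hA0 zero_le_one hX
    rw [hg', hΨ, Psi3, hA]; rw [hA] at this; exact this
  have hσ10 : 0 ≤ scale a₁ 0 (X + 1) := scale_nonneg (by linarith)
  have hC0 : 0 ≤ C := le_trans zero_le_one hC
  have hρ : rho3 n (m' + 1) (X + 1) = 4 * Psi3 n (m' + 1) (X + 1) := rfl
  have hσpow : σX ^ (k + 1) = scale (a₁ * ((k : ℝ) + 1)) 0 X := by
    rw [hσ, scale_pow hX1]; push_cast; ring_nf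
  have hK : Kmain3 m' k C a₁ A = 2 * C * g ^ (k + 1) * (1 + (4 * g' * T) ^ (k + 1)) * T := by
    rw [Kmain3, ← hg, ← hg', ← hT]
  -- Step 1: replace the values at `X + 1` by those at `X`
  have step1 : C * (scale a₁ 0 (X + 1) + scale a₁ 0 (X + 1)) * scale a₁ 0 (X + 1) ^ k *
      (s ^ (k + 1) + rho3 n (m' + 1) (X + 1) ^ (k + 1)) ≤
      2 * C * (g * σX) ^ (k + 1) * (s ^ (k + 1) + (4 * (g' * Ψ)) ^ (k + 1)) := by
    have e : C * (scale a₁ 0 (X + 1) + scale a₁ 0 (X + 1)) * scale a₁ 0 (X + 1) ^ k =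
        2 * C * scale a₁ 0 (X + 1) ^ (k + 1) := by ring
    rw [e, hρ]
    have hρle : 4 * Psi3 n (m' + 1) (X + 1) ≤ 4 * (g' * Ψ) := by linarith
    have hΨ10 : 0 ≤ 4 * Psi3 n (m' + 1) (X + 1) := by
      have : 0 ≤ Psi3 n (m' + 1) (X + 1) := scale_nonneg (by linarith); linarith
    gcongr
  -- Step 2: the right-hand side is `(K/T) σX^{k+1} s^{k+1}`
  have step2 : 2 * C * (g * σX) ^ (k + 1) * (s ^ (k + 1) + (4 * (g' * Ψ)) ^ (k + 1)) =
      (2 * C * g ^ (k + 1) * (1 + (4 * g' * T) ^ (k + 1))) * σX ^ (k + 1) * s ^ (k + 1) := by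
    rw [hΨs, mul_pow g σX, show 4 * (g' * (T * s)) = (4 * g' * T) * s by ring, mul_pow (4 * g' * T) s]
    ring
  -- Step 3: the domination `K σX^{k+1} ≤ Ψ = T s`
  have step3 : (2 * C * g ^ (k + 1) * (1 + (4 * g' * T) ^ (k + 1))) * σX ^ (k + 1) ≤ s := by
    have h1 : Kmain3 m' k C a₁ A * σX ^ (k + 1) ≤ T * s := by rw [hσpow, ← hΨs]; exact hE
    rw [hK] at h1
    have h2 : T * ((2 * C * g ^ (k + 1) * (1 + (4 * g' * T) ^ (k + 1))) * σX ^ (k + 1)) ≤ T * s := by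
      calc _ = 2 * C * g ^ (k + 1) * (1 + (4 * g' * T) ^ (k + 1)) * T * σX ^ (k + 1) := by ring
        _ ≤ T * s := h1
    exact le_of_mul_le_mul_left h2 hT0
  have hsk : 0 ≤ s ^ (k + 1) := pow_nonneg hs0 _
  calc C * (scale a₁ 0 (X + 1) + scale a₁ 0 (X + 1)) * scale a₁ 0 (X + 1) ^ k *
        (s ^ (k + 1) + rho3 n (m' + 1) (X + 1) ^ (k + 1))
      ≤ 2 * C * (g * σX) ^ (k + 1) * (s ^ (k + 1) + (4 * (g' * Ψ)) ^ (k + 1)) := step1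
    _ = (2 * C * g ^ (k + 1) * (1 + (4 * g' * T) ^ (k + 1))) * σX ^ (k + 1) * s ^ (k + 1) := step2
    _ ≤ s * s ^ (k + 1) := mul_le_mul_of_nonneg_right step3 hsk
    _ = s ^ (k + 2) := by ring


/-! ### The exponent bookkeeping -/

/-- With `K = ⌈mn/(m+n)⌉ ≥ 1` and `k = K - 1`: `k(m+n) < mn`. [folklore] -/
theorem k_mul_lt {m n K : ℕ} (hK : K = ⌈((m : ℚ) * n) / ((m : ℚ) + n)⌉₊) (hK1 : 1 ≤ K) (hm : 1 ≤ m) (hn : 1 ≤ n) :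
    ((K - 1 : ℕ) : ℝ) * ((m : ℝ) + n) < (m : ℝ) * n := by
  have hlt : K - 1 < K := by omega
  rw [hK] at hlt
  have hq := Nat.lt_ceil.mp hlt
  have hpos : (0 : ℚ) < (m : ℚ) + n := by positivity
  rw [lt_div_iff₀ hpos] at hq
  rw [hK]
  exact_mod_cast hq

end DiazMainIII

open DiazMainIII

/-- **Laurent's Théorème 3 iii) (Diaz 1989; Philippon 1986, Thm 2.12 (i)) from Philippon's criterion
(Thm 2.11) and Philippon's zero estimate on `𝔾ₐ × 𝔾ₘⁿ`.** In the large range `mn > 2(m+n)`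
(the ranges `mn ≤ 2(m+n)` are `Diaz1989_main_iii_smallRange`), apply the criterion at
`θ = (y, x, e^{xy}) ∈ ℂ^{n+m+nm}` (`x` the `m` points, with a linear measure of independence;
`y` the `n` frequencies) with the family `Q_{l,t,j}` of Gel'fond's method WITH derivatives
(`DiazMainIIIConstruction.lean`), `σ = δ = X^{1+m/n+ε₁}`, `R = ρ = 4Ψ`, `S = Ψ/2^{m+4}`
(`Ψ = X^{1+m/n+m} log X`) and `k + 1 = ⌈mn/(m+n)⌉`: the family is small at `θ`
(`eventually_small3`), has no common zero in the ball of radius `e^{-ρ}` (`eventually_zeroFree3`,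
from `Philippon1986_GaGm`), and the growth conditions hold because `(k+1)(1 + m/n) < 1 + m/n + m`,
i.e. `k < mn/(m+n)`.
[cite: Laurent1991, §3.1, Théorème 3 iii), p. 213] [cite: Diaz1989, Théorème 1 & Critère p. 16 (the model)] -/
theorem Diaz1989_main_iii_of_criterion (hC : Philippon1986_mainCriterion) (hZ : Philippon1986_GaGm) :
    Diaz1989_main_iii := by
  refine Diaz1989_main_iii_of_largeRange' fun m n x y hx hy hxm hym hm3 hn3 hlt hK3 => ?_
  obtain ⟨m', rfl⟩ : ∃ m', m = m' + 1 := ⟨m - 1, by omega⟩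
  have hm' : 1 ≤ m' := by omega
  have hn1 : 1 ≤ n := by omega
  have hm1 : 1 ≤ m' + 1 := by omega
  -- the exponent `k + 1 = ⌈mn/(m+n)⌉`
  set K : ℕ := ⌈(((m' + 1 : ℕ) : ℚ) * n) / (((m' + 1 : ℕ) : ℚ) + n)⌉₊ with hKdef
  have hK1 : 1 ≤ K := le_trans (by norm_num) hK3
  set k : ℕ := K - 1 with hkdef
  have hk1 : k + 1 = K := Nat.sub_add_cancel hK1
  have hr : (k : ℝ) * (((m' + 1 : ℕ) : ℝ) + n) < ((m' + 1 : ℕ) : ℝ) * n := k_mul_lt hKdef hK1 hm1 hn1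
  -- the real exponents
  have hn0 : (0 : ℝ) < n := by exact_mod_cast (show 0 < n by omega)
  have hM1 : (1 : ℝ) ≤ ((m' + 1 : ℕ) : ℝ) := by exact_mod_cast hm1
  set Mr : ℝ := ((m' + 1 : ℕ) : ℝ) with hMr
  set a₀ : ℝ := 1 + Mr / n with ha₀
  set A : ℝ := 1 + Mr / n + Mr with hA
  set ε₀ : ℝ := A - ((k : ℝ) + 1) * a₀ with hε₀
  have hε₀eq : ε₀ = (Mr * n - k * (Mr + n)) / n := by
    rw [hε₀, hA, ha₀]; field_simp; ring
  have hε₀pos : 0 < ε₀ := by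
    rw [hε₀eq]; exact div_pos (by linarith) hn0
  set ε₁ : ℝ := ε₀ / (2 * ((k : ℝ) + 1)) with hε₁
  have hε₁pos : 0 < ε₁ := by rw [hε₁]; positivity
  set a₁ : ℝ := a₀ + ε₁ with ha₁
  have ha₀1 : 1 ≤ a₀ := by rw [ha₀]; linarith [(by positivity : (0 : ℝ) ≤ Mr / n)]
  have ha₁gt : 1 + Mr / n < a₁ := by rw [ha₁, ha₀]; linarith
  have ha₁1 : 1 ≤ a₁ := by linarith
  have ha₁0 : 0 ≤ a₁ := by linarith
  have hka₁ : a₁ * ((k : ℝ) + 1) = A - ε₀ / 2 := by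
    rw [ha₁, hε₁, hε₀]; field_simp; ring
  have hk_le : a₁ * ((k : ℝ) + 1) ≤ 1 + Mr / n + Mr := by rw [hka₁, hA]; linarith
  have hdomlt : a₁ * ((k : ℝ) + 1) < 1 + Mr / n + Mr := by rw [hka₁, hA]; linarith
  -- the measures
  obtain ⟨Cx, hCx0, hxmeas⟩ := hxm
  obtain ⟨Cy, hCy0, hymeas⟩ := hym
  have hn1r : (1 : ℝ) ≤ n := by exact_mod_cast hn1
  have hden : (0 : ℝ) < 2 * Mr + n := by positivity
  have hη0 : (0 : ℝ) ≤ (Mr * n + Mr + n - 1) / (2 * Mr + n) :=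
    div_nonneg (by nlinarith) hden.le
  have hηb : (Mr * n + Mr + n - 1) / (2 * Mr + n) * (Mr / n) < 1 + Mr / n + Mr := by
    have key : (Mr * n + Mr + n - 1) / (2 * Mr + n) * Mr < n + Mr + Mr * n := by
      calc (Mr * n + Mr + n - 1) / (2 * Mr + n) * Mr ≤ (Mr * n + Mr + n - 1) / (2 * Mr + n) * (2 * Mr + n) :=
            mul_le_mul_of_nonneg_left (by linarith) hη0
        _ = Mr * n + Mr + n - 1 := div_mul_cancel₀ _ hden.ne'
        _ < n + Mr + Mr * n := by linarith
    rw [show (Mr * n + Mr + n - 1) / (2 * Mr + n) * (Mr / n) = (Mr * n + Mr + n - 1) / (2 * Mr + n) * Mr / n by ring,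
      show 1 + Mr / n + Mr = (n + Mr + Mr * n) / n by field_simp]
    exact div_lt_div_of_pos_right key hn0
  have hxlast : x (Fin.last m') ≠ 0 := hx.ne_zero (Fin.last m')
  -- no common zero in the ball, and the smallness, eventually
  obtain ⟨c, hzf⟩ := eventually_zeroFree3 hZ hn1 hm' y x hη0 hηb hymeas hxmeas
  have hsmall := eventually_small3 hn1 y x hxlast hCx0.le hxmeas c
  -- the transported point `θ ∈ ℂ^q`
  set eV := varEquiv3 n (m' + 1) with heV
  set θq : Fin (n + ((m' + 1) + n * (m' + 1))) → ℂ := pt y x ∘ eV.symm with hθq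
  have hkn : k < n := by
    have hr' := hr
    rw [hMr] at hr'
    have hnat : k * ((m' + 1) + n) < (m' + 1) * n := by exact_mod_cast hr'
    by_contra hge
    push Not at hge
    have : n * ((m' + 1) + n) ≤ k * ((m' + 1) + n) := Nat.mul_le_mul_right _ hge
    nlinarith
  have hkq : k ≤ n + ((m' + 1) + n * (m' + 1)) := by omega
  obtain ⟨C, hC1, hcrit⟩ := hC _ k θq hkq
  -- a threshold beyond which every `X` is good and the domination of the main inequality holds
  have hev := (eventually_goodX3 (y := y) (x := x) hn1 ha₁gt c hsmall hzf).and
    (eventually_mul_scale_le_of_lt hdomlt 0 1 (Kmain3 m' k C a₁ (1 + Mr / n + Mr)))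
  obtain ⟨X₀, hX₀⟩ := Filter.eventually_atTop.mp hev
  set N₁ : ℕ := ⌈max X₀ 0⌉₊ + 3 with hN₁def
  have hN₁3 : 3 ≤ N₁ := by omega
  have hXN : ∀ N : ℕ, X₀ ≤ (N : ℝ) + N₁ := fun N => by
    have h1 : X₀ ≤ ⌈max X₀ 0⌉₊ := (le_max_left _ _).trans (Nat.le_ceil _)
    have h2 : (N₁ : ℝ) = (⌈max X₀ 0⌉₊ : ℝ) + 3 := by rw [hN₁def]; push_cast; ring
    have h3 : (0 : ℝ) ≤ N := Nat.cast_nonneg N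
    linarith
  have hG : ∀ N : ℕ, GoodX3 y x a₁ c ((N : ℝ) + N₁) := fun N => (hX₀ _ (hXN N)).1
  have hE : ∀ N : ℕ, Kmain3 m' k C a₁ (1 + Mr / n + Mr) * scale (a₁ * ((k : ℝ) + 1)) 0 ((N : ℝ) + N₁) ≤
      Psi3 n (m' + 1) ((N : ℝ) + N₁) := fun N => (hX₀ _ (hXN N)).2
  -- the criterion
  have main := hcrit (sigF3 a₁ N₁) (sigF3 a₁ N₁) (RF3 n m' N₁) (SF3 n m' N₁)
    (sigF3_mono hN₁3 ha₁0) (sigF3_mono hN₁3 ha₁0) (RF3_mono hN₁3) (SF3_mono hN₁3)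
    (one_le_sigF3 hN₁3 ha₁1) (one_le_sigF3 hN₁3 ha₁1) (one_le_RF3 hN₁3) (fun N => (hG N).S_ge)
    (tendsto_sigF3 hN₁3 ha₁1) (ratio_mono3 hN₁3 hk_le)
    (fun N => by
      have h := main_ineq_at3 (n := n) (m' := m') (k := k) hC1 ha₁0 (by linarith [three_le_X hN₁3 N]) (hE N)
      have e : (((N + 1 : ℕ)) : ℝ) + N₁ = ((N : ℝ) + N₁) + 1 := by push_cast; ring
      simp only [sigF3, RF3, SF3]
      rw [e]
      exact h)
    0 (fun N => Fintype.card (FamIdx3 n m' c ((N : ℝ) + N₁)))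
    (fun N i => rename eV (famPoly3 y x c ((N : ℝ) + N₁) ((Fintype.equivFin _).symm i)))
    (fun N _ => by
      have hGN := hG N
      have hθ : θq ∘ eV = pt y x := by
        funext v; simp [hθq]
      refine ⟨?_, ?_, ?_, ?_, ?_⟩
      · -- no common zero in the ball of radius `e^{-R(N)} = e^{-ρ}`
        refine Set.finite_empty.subset ?_
        rintro z ⟨hz, hz0⟩
        have hball : InBall3 y x ((N : ℝ) + N₁) (z ∘ eV) := fun v => by
          have := hz (eV v)
          simpa [hθq, RF3] using this
        obtain ⟨i, hi⟩ := hGN.exists_ne_zero hn1 hball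
        apply hi
        have := hz0 (Fintype.equivFin _ i)
        rwa [aeval_rename, Equiv.symm_apply_apply] at this
      · intro j
        refine le_trans ?_ (hGN.degLen_famPoly hn1 ((Fintype.equivFin _).symm j)).1
        exact_mod_cast totalDegree_rename_le _ _
      · intro j
        rw [l1_rename_of_injective eV.injective]
        exact (hGN.degLen_famPoly hn1 ((Fintype.equivFin _).symm j)).2
      · obtain ⟨i, hi⟩ := hGN.exists_ne_zero_pt hn1
        refine ⟨Fintype.equivFin _ i, ?_⟩
        rwa [aeval_rename, hθ, Equiv.symm_apply_apply]
      · intro j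
        rw [aeval_rename, hθ, SF3]
        exact hGN.small_famPoly hn1 ((Fintype.equivFin _).symm j))
  -- conclusion: `ℚ(θ) = ℚ(x, y, e^{xy})` and `k + 1 = ⌈mn/(m+n)⌉`
  have hf : Set.range (fun ik : Fin n × Fin (m' + 1) => cexp (y ik.1 * x ik.2)) =
      Set.range (fun p : Fin (m' + 1) × Fin n => cexp (x p.1 * y p.2)) := by
    ext z
    simp only [Set.mem_range, Prod.exists]
    constructor
    · rintro ⟨i, j, rfl⟩; exact ⟨j, i, by rw [mul_comm]⟩
    · rintro ⟨j, i, rfl⟩; exact ⟨i, j, by rw [mul_comm]⟩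
  have hrange : Set.range θq = Set.range x ∪ Set.range y ∪
      Set.range (fun p : Fin (m' + 1) × Fin n => cexp (x p.1 * y p.2)) := by
    rw [hθq, eV.symm.surjective.range_comp, pt, Set.Sum.elim_range, Set.Sum.elim_range, hf]
    ext z
    simp only [Set.mem_union]
    tauto
  have hfin : ((K : ℕ) : Cardinal) ≤ Algebra.trdeg ℚ ↥(IntermediateField.adjoin ℚ (Set.range θq)) := by
    rw [← hk1]; exact main
  exact hfin.trans_eq (trdeg_adjoin_congr hrange)

end Literature.NumberTheory.Transcendental

end
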